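import Summits.ResolutionOfSingularities.ResolutionOfSingularities.Theorems.WallFrames7
import Summits.ResolutionOfSingularities.ResolutionOfSingularities.Theorems.NearCutCompanion3
import Summits.ResolutionOfSingularities.ResolutionOfSingularities.Theorems.NearCutWalls2
import Summits.ResolutionOfSingularities.ResolutionOfSingularities.Theorems.ProximityCutArcLaw
import Summits.ResolutionOfSingularities.ResolutionOfSingularities.Theorems.MaxContactCutBoundaryLedger
import Summits.ResolutionOfSingularities.ResolutionOfSingularities.Theorems.MaxContactCutWallCut
import Summits.ResolutionOfSingularities.ResolutionOfSingularities.Theorems.PlanarGhostDescent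
import Literature.AlgebraicGeometry.Resolution.PointBlowupIFPGiraud
import Literature.AlgebraicGeometry.Resolution.AdicNoetherian
import HarnessLib

/-!
# WallFrames (8/17) — Kollár's wall descent in a polynomial frame; sections: Presentation (cont.), Exhibit, Transversal

Verbatim slice of the farm-checked monolith `WallFrames.lean` of cell `decomp-res`, seat `decomp-res-lens-5`, g35
(sha256 7405a21d81d102a4…, monolith lines 1876–2140); one namespace `Summit.ResolutionOfSingularities.ResolutionOfSingularities.Theorems.WallFrames` across the
slices, imports chained.  The monolith's module docstring (laws W1–W7, mechanism, novelty, honest placement) is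
reproduced in slice 1; the main theorem `balancedWallPort_holds : WallCut.BalancedWallPort` (hypothesis-free) and the
host-route corollary `ecBalancedWallPort_holds` (aside item 27368 of route MaxContactCut) are in slice 16/17.
-/

open MvPolynomial Finset
open scoped BigOperators
open Literature.AlgebraicGeometry.Resolution
open Literature.AlgebraicGeometry.Resolution.Hauser2010
open Literature.AlgebraicGeometry.Resolution.PointBlowup
open Literature.AlgebraicGeometry.Resolution.HauserPerlega2024

namespace Summit.ResolutionOfSingularities.ResolutionOfSingularities.Theorems.WallFrames

variable {σ : Type*} [Fintype σ] [DecidableEq σ] {K : Type*} [Field K]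

section Presentation

omit [Fintype σ] in
/-- **FREE-CHART PRESENTATION TRANSPORT (rotation substitution `Ψ = rotSubst`).**  For pairwise distinct `u, v, z`
and `A + B + k ≥ s`, `Ψ(y_u^A y_v^B y_z^k · U) = y_z^s · (y_u^A y_z^{A+B+k-s} y_v^k · U' + y_u^A y_z^{A+B+k-s} · U″ · ((Q̃ y_v + r)^k − (Q̃ y_v)^k))`
with `U' = Ψ(U) (y_v + β + ζ'')^B Q̃^k`, `U″ = Ψ(U) (y_v + β + ζ'')^B`: the index moves by Kollár's step EXACTLY,
the rest is divisible by `r` (`sub_pow_mem_span`). [new] -/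
theorem freeChart_presentation {u v z : σ} (huv : u ≠ v) (huz : u ≠ z) (hvz : v ≠ z) (β : K)
    (ζ₂ Q r U : MvPolynomial σ K) {A B k s : ℕ} (hs : s ≤ A + B + k) :
    rotSubst u v z β ζ₂ Q r (X u ^ A * X v ^ B * X z ^ k * U) =
      X z ^ s * (X u ^ A * X z ^ (A + B + k - s) * X v ^ k *
          (rotSubst u v z β ζ₂ Q r U * (X v + C β + ζ₂) ^ B * Q ^ k) +
        X u ^ A * X z ^ (A + B + k - s) *
          (rotSubst u v z β ζ₂ Q r U * (X v + C β + ζ₂) ^ B * ((Q * X v + r) ^ k - (Q * X v) ^ k))) := by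
  rw [map_mul, map_mul, map_mul, map_pow, map_pow, map_pow, rotSubst_X_u, rotSubst_X_v huv,
    rotSubst_X_z huz hvz]
  obtain ⟨m, hm⟩ : ∃ m, A + B + k = s + m := ⟨A + B + k - s, by omega⟩
  rw [hm, Nat.add_sub_cancel_left]
  have hk : (X u * X z : MvPolynomial σ K) ^ A * (X z * (X v + C β + ζ₂)) ^ B * (X z * (Q * X v + r)) ^ k =
      X z ^ (s + m) * (X u ^ A * (X v + C β + ζ₂) ^ B * (Q * X v + r) ^ k) := by
    rw [mul_pow, mul_pow, mul_pow, ← hm, show (X z : MvPolynomial σ K) ^ (A + B + k) = X z ^ A * X z ^ B * X z ^ k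
      by rw [← pow_add, ← pow_add]]; ring
  rw [hk]; ring

omit [Fintype σ] [DecidableEq σ] in
/-- The free-chart remainder is wall-deep: `(Q̃V + r)^k − (Q̃V)^k ∈ (r)`. [folklore] -/
theorem sub_pow_mem_span (Q r V : MvPolynomial σ K) (k : ℕ) :
    (Q * V + r) ^ k - (Q * V) ^ k ∈ Ideal.span {r} := by
  rw [Ideal.mem_span_singleton]
  have h := sub_dvd_pow_sub_pow (Q * V + r) (Q * V) k
  rwa [add_sub_cancel_left] at h

omit [Fintype σ] in
/-- The new cofactor of the free-chart transport is a UNIT: `U'(0) = U(0) · β^B · Q̃(0)^k` (`ζ''(0) = 0`). [new] -/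
theorem constantCoeff_freeChart_unit {u v z : σ} (β : K) {ζ₂ : MvPolynomial σ K} (hζ₂ : constantCoeff ζ₂ = 0)
    (Q r U : MvPolynomial σ K) (B k : ℕ) :
    constantCoeff (rotSubst u v z β ζ₂ Q r U * (X v + C β + ζ₂) ^ B * Q ^ k) =
      constantCoeff U * β ^ B * constantCoeff Q ^ k := by
  rw [map_mul, map_mul, map_pow, map_pow, constantCoeff_rotSubst β hζ₂, map_add, map_add, constantCoeff_X,
    constantCoeff_C, hζ₂, zero_add, add_zero]

omit [Fintype σ] in
/-- Over three letters a monomial is the product of the three powers. [folklore] -/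
theorem monomial_eq_of_three {u v z : σ} (huv : u ≠ v) (huz : u ≠ z) (hvz : v ≠ z) (hσ : ∀ i, i = u ∨ i = v ∨ i = z)
    (n : σ →₀ ℕ) (c : K) :
    (monomial n c : MvPolynomial σ K) = C c * (X u ^ n u * X v ^ n v * X z ^ n z) := by
  classical
  have hsub : n.support ⊆ ({u, v, z} : Finset σ) := by
    intro i _
    rcases hσ i with h | h | h <;> simp [h]
  rw [monomial_eq, Finsupp.prod_of_support_subset n hsub (fun i e => X i ^ e) (fun i _ => pow_zero _),
    Finset.prod_insert (by simp [huv, huz]), Finset.prod_insert (by simp [hvz]), Finset.prod_singleton, mul_assoc]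

/-- Over three letters the degree is the sum of the three exponents. [folklore] -/
theorem degree_eq_of_three {u v z : σ} (huv : u ≠ v) (huz : u ≠ z) (hvz : v ≠ z) (hσ : ∀ i, i = u ∨ i = v ∨ i = z)
    (n : σ →₀ ℕ) : n.degree = n u + n v + n z := by
  classical
  have huniv : (Finset.univ : Finset σ) = {u, v, z} := by
    ext i
    simp only [Finset.mem_univ, Finset.mem_insert, Finset.mem_singleton, true_iff]
    exact hσ i
  rw [Finsupp.degree_eq_sum, huniv, Finset.sum_insert (by simp [huv, huz]), Finset.sum_insert (by simp [hvz]),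
    Finset.sum_singleton, add_assoc]

omit [Fintype σ] [DecidableEq σ] in
/-- Repackaging the free-chart main term as a labelled monomial: `y_u^A y_z^B y_v^C = y^{A e_u + B e_z + C e_v}`. [folklore] -/
theorem X_pow_mul_eq_monomial (u v z : σ) (A B C : ℕ) :
    (X u ^ A * X z ^ B * X v ^ C : MvPolynomial σ K) =
      monomial (Finsupp.single u A + Finsupp.single z B + Finsupp.single v C) 1 := by
  rw [X_pow_eq_monomial, X_pow_eq_monomial, X_pow_eq_monomial, monomial_mul, monomial_mul, mul_one, mul_one]

omit [Fintype σ] in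
/-- The free-chart index map `n ↦ n_u e_u + (|n| − s) e_z + n_z e_v` (Kollár's step with the rôle change free `z` →
wall `E`, lost wall `v` → free) is INJECTIVE on indices of degree `≥ s`. [folklore] -/
theorem rotIndex_injOn {u v z : σ} (huv : u ≠ v) (huz : u ≠ z) (hvz : v ≠ z) (hσ : ∀ i, i = u ∨ i = v ∨ i = z)
    (s : ℕ) {n n' : σ →₀ ℕ} (hn : s ≤ n u + n v + n z) (hn' : s ≤ n' u + n' v + n' z)
    (h : Finsupp.single u (n u) + Finsupp.single z (n u + n v + n z - s) + Finsupp.single v (n z) =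
      Finsupp.single u (n' u) + Finsupp.single z (n' u + n' v + n' z - s) + Finsupp.single v (n' z)) : n = n' := by
  classical
  have hu := congrArg (fun m => m u) h
  have hv := congrArg (fun m => m v) h
  have hz := congrArg (fun m => m z) h
  simp only [Finsupp.add_apply, Finsupp.single_apply, if_true, if_neg huz, if_neg huv, if_neg hvz.symm,
    if_neg huz.symm, if_neg huv.symm, if_neg hvz] at hu hv hz
  ext i
  rcases hσ i with hi | hi | hi <;> subst hi <;> omega

/-- **PRESENTATION ROTATION (free-chart move, packaged).**  Under a free-chart move (chart `z` = the free variable,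
centre `b = β e_v` on the lost wall `v`, `β ≠ 0` in use) with the new frame germ factorised as
`translate b (1 − cT_1^z ζ) = Q_g (y_v − ζ'') + r_g`, a unit-weighted presentation `σ_ζ G = Σ_{n∈S} y^n U_n + R` of the
old sheared companion yields the EXPLICIT expansion of the new sheared companion `σ_{ζ''}^{(v)} (translate b (cT_s^z G))`:
main terms `y_u^{n_u} y_z^{|n|−s} y_v^{n_z} · (Ψ U_n · (y_v + β + ζ'')^{n_v} · Q̃^{n_z})` (new index `(n_u, n_z, |n| − s)` in
the letters `(u, v, z)`: the toric map with the rôles free `z` → wall `E`, lost wall `v` → free; UNIT cofactor by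
`constantCoeff_freeChart_unit`), plus remainders that are multiples of `r_g` (`sub_pow_mem_span`), plus the image of
the far part `R` monomial by monomial.  (`Q̃ = σ_{ζ''}^{(v)} Q_g`, `Ψ = rotSubst u v z β ζ'' Q̃ r_g`.) [new] -/
theorem presentation_freeChart {u v z : σ} (huv : u ≠ v) (huz : u ≠ z) (hvz : v ≠ z) (hσ : ∀ i, i = u ∨ i = v ∨ i = z)
    {b : σ → K} {β : K} (hbv : b v = β) (hb : ∀ i, i ≠ v → b i = 0)
    {ζ : MvPolynomial σ K} (hζ : (∀ μ ∈ ζ.support, μ z = 0)) (hζ1 : (1 : ℕ∞) ≤ ordZero ζ)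
    {ζ₂ Qg rg : MvPolynomial σ K} (hζ₂ : (∀ μ ∈ ζ₂.support, μ v = 0)) (hrg : (∀ μ ∈ rg.support, μ v = 0))
    (hg : PointBlowup.translate b (1 - chartTransform 1 z ζ) = Qg * (X v - ζ₂) + rg)
    {s : ℕ} {G : MvPolynomial σ K} (hs : (s : ℕ∞) ≤ ordZero G)
    {α : Type*} {A : Finset α} {ι : α → σ →₀ ℕ} {U : α → MvPolynomial σ K} {R : MvPolynomial σ K}
    (hS : ∀ a ∈ A, s ≤ (ι a).degree) (hRs : ∀ d ∈ R.support, s ≤ d.degree)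
    (hpres : zshear z ζ G = ∑ a ∈ A, monomial (ι a) 1 * U a + R) :
    zshear v ζ₂ (PointBlowup.translate b (chartTransform s z G)) =
      ∑ a ∈ A, X u ^ (ι a) u * X z ^ ((ι a) u + (ι a) v + (ι a) z - s) * X v ^ (ι a) z *
          (rotSubst u v z β ζ₂ (zshear v ζ₂ Qg) rg (U a) * (X v + C β + ζ₂) ^ (ι a) v * (zshear v ζ₂ Qg) ^ (ι a) z)
      + ∑ a ∈ A, X u ^ (ι a) u * X z ^ ((ι a) u + (ι a) v + (ι a) z - s) *
          (rotSubst u v z β ζ₂ (zshear v ζ₂ Qg) rg (U a) * (X v + C β + ζ₂) ^ (ι a) v *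
            ((zshear v ζ₂ Qg * X v + rg) ^ (ι a) z - (zshear v ζ₂ Qg * X v) ^ (ι a) z))
      + ∑ d ∈ R.support, (X u ^ d u * X z ^ (d u + d v + d z - s) * X v ^ d z *
          (rotSubst u v z β ζ₂ (zshear v ζ₂ Qg) rg (C (coeff d R)) * (X v + C β + ζ₂) ^ d v * (zshear v ζ₂ Qg) ^ d z)
        + X u ^ d u * X z ^ (d u + d v + d z - s) *
          (rotSubst u v z β ζ₂ (zshear v ζ₂ Qg) rg (C (coeff d R)) * (X v + C β + ζ₂) ^ d v *
            ((zshear v ζ₂ Qg * X v + rg) ^ d z - (zshear v ζ₂ Qg * X v) ^ d z))) := by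
  classical
  set Ψ := rotSubst u v z β ζ₂ (zshear v ζ₂ Qg) rg with hΨ
  set W : MvPolynomial σ K := X v + C β + ζ₂ with hW
  set Qt := zshear v ζ₂ Qg with hQt
  have hXz : (X z : MvPolynomial σ K) ^ s ≠ 0 := pow_ne_zero _ (X_ne_zero z)
  have hterm : ∀ (n : σ →₀ ℕ) (V : MvPolynomial σ K), s ≤ n.degree →
      Ψ (monomial n 1 * V) = X z ^ s * (X u ^ n u * X z ^ (n u + n v + n z - s) * X v ^ n z * (Ψ V * W ^ n v * Qt ^ n z) +
        X u ^ n u * X z ^ (n u + n v + n z - s) * (Ψ V * W ^ n v * ((Qt * X v + rg) ^ n z - (Qt * X v) ^ n z))) := by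
    intro n V hn
    rw [monomial_eq_of_three huv huz hvz hσ n 1, C_1, one_mul]
    rw [degree_eq_of_three huv huz hvz hσ n] at hn
    exact freeChart_presentation huv huz hvz β ζ₂ Qt rg V hn
  have hsumS : ∑ a ∈ A, Ψ (monomial (ι a) 1 * U a) =
      X z ^ s * (∑ a ∈ A, X u ^ (ι a) u * X z ^ ((ι a) u + (ι a) v + (ι a) z - s) * X v ^ (ι a) z *
          (Ψ (U a) * W ^ (ι a) v * Qt ^ (ι a) z) +
        ∑ a ∈ A, X u ^ (ι a) u * X z ^ ((ι a) u + (ι a) v + (ι a) z - s) *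
          (Ψ (U a) * W ^ (ι a) v * ((Qt * X v + rg) ^ (ι a) z - (Qt * X v) ^ (ι a) z))) := by
    rw [Finset.sum_congr rfl fun a ha => hterm (ι a) (U a) (hS a ha), ← Finset.mul_sum, Finset.sum_add_distrib]
  have hsumR : Ψ R = X z ^ s * ∑ d ∈ R.support,
      (X u ^ d u * X z ^ (d u + d v + d z - s) * X v ^ d z * (Ψ (C (coeff d R)) * W ^ d v * Qt ^ d z) +
        X u ^ d u * X z ^ (d u + d v + d z - s) *
          (Ψ (C (coeff d R)) * W ^ d v * ((Qt * X v + rg) ^ d z - (Qt * X v) ^ d z))) := by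
    conv_lhs => rw [R.as_sum, map_sum]
    rw [Finset.mul_sum]
    refine Finset.sum_congr rfl fun d hd => ?_
    rw [show monomial d (coeff d R) = monomial d (1 : K) * C (coeff d R) by rw [mul_comm, C_mul_monomial, mul_one]]
    exact hterm d (C (coeff d R)) (hRs d hd)
  apply mul_left_cancel₀ hXz
  rw [freeChart_conjugation huv huz hvz hbv hb hζ hζ1 hζ₂ hrg hg hs, hpres, map_add, map_sum, hsumS, hsumR]
  ring

omit [Fintype σ] in
/-- **INITIAL PRESENTATION.**  Any polynomial splits, at wall-degree threshold `Λ` off the free variable `z`, into its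
near monomials (unit-weighted by their non-zero coefficients) and a far part. [folklore] -/
theorem presentation_of_support (z : σ) (Λ : ℕ) (P : MvPolynomial σ K) :
    P = ∑ n ∈ P.support.filter (fun n => n.degree < Λ + n z), monomial n (1 : K) * C (coeff n P) +
        ∑ n ∈ P.support.filter (fun n => ¬ n.degree < Λ + n z), monomial n (coeff n P) ∧
      (∀ n ∈ P.support.filter (fun n => n.degree < Λ + n z), constantCoeff (C (coeff n P) : MvPolynomial σ K) ≠ 0) ∧
      ∀ d ∈ (∑ n ∈ P.support.filter (fun n => ¬ n.degree < Λ + n z), monomial n (coeff n P)).support,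
        Λ + d z ≤ d.degree := by
  classical
  refine ⟨?_, ?_, ?_⟩
  · have hmon : ∀ n : σ →₀ ℕ, (monomial n (1 : K) : MvPolynomial σ K) * C (coeff n P) = monomial n (coeff n P) :=
      fun n => by rw [mul_comm, C_mul_monomial, mul_one]
    simp only [hmon]
    rw [Finset.sum_filter_add_sum_filter_not]
    exact P.as_sum
  · intro n hn
    rw [constantCoeff_C]
    exact mem_support_iff.mp (Finset.mem_filter.mp hn).1
  · intro d hd
    obtain ⟨n, hn, hdn⟩ := Finset.mem_biUnion.mp (support_sum hd)
    have hdn' : d = n := by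
      have := support_monomial_subset hdn
      rwa [Finset.mem_singleton] at this
    subst hdn'
    have := (Finset.mem_filter.mp hn).2
    omega

omit [Fintype σ] in
/-- **JET RE-EXTRACTION keeps the near presentation.**  Deepening the shear by a `z`-free `ε` of wall-degree `≥ Λ`
changes only the far part (threshold `Λ`): the index set and the units are untouched (`zshear_sub_self_mem_span` +
`mem_span_far_iff`). [new] -/
theorem presentation_reshear {z : σ} {ζ ε : MvPolynomial σ K} (hζ : (∀ μ ∈ ζ.support, μ z = 0))
    (hε : (∀ μ ∈ ε.support, μ z = 0)) {Λ : ℕ} (hεΛ : ∀ d ∈ ε.support, Λ ≤ d.degree)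
    {G : MvPolynomial σ K} {α : Type*} {A : Finset α} {ι : α → σ →₀ ℕ} {U : α → MvPolynomial σ K}
    {R : MvPolynomial σ K} (hR : ∀ d ∈ R.support, Λ + d z ≤ d.degree)
    (hpres : zshear z ζ G = ∑ a ∈ A, monomial (ι a) 1 * U a + R) :
    ∃ R' : MvPolynomial σ K, (∀ d ∈ R'.support, Λ + d z ≤ d.degree) ∧
      zshear z (ζ + ε) G = ∑ a ∈ A, monomial (ι a) 1 * U a + R' := by
  classical
  set J : Ideal (MvPolynomial σ K) :=
    Ideal.span ((fun m => monomial m (1 : K)) '' {m : σ →₀ ℕ | Λ + m z ≤ m.degree}) with hJ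
  have hεJ : ε ∈ J := mem_span_far_iff.mpr fun d hd => by
    have h1 := hε d hd; have h2 := hεΛ d hd; omega
  have hRJ : R ∈ J := mem_span_far_iff.mpr hR
  set P := zshear z ζ G with hP
  have hdiff : zshear z ε P - P ∈ J :=
    ((Ideal.span_singleton_le_iff_mem J).mpr hεJ) (zshear_sub_self_mem_span z ε P)
  refine ⟨R + (zshear z ε P - P), mem_span_far_iff.mp (Ideal.add_mem _ hRJ hdiff), ?_⟩
  rw [← zshear_zshear hζ, ← hP]
  have : zshear z ε P = P + (zshear z ε P - P) := by ring
  rw [this, hpres]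
  ring

end Presentation

/-! ## §12 Falsifier exhibit: a free-chart balanced near move in which the lost wall's coordinate survives as a unit

State `F = y_u y_v (y_z + y_v)^3`: `r = e_u + e_v` (δ = 1), companion `G = ℓ^3`, `ℓ = y_z + y_v`, shade `s = 3`,
`q = p^e = 4 = 2²`: a δ-balanced TAME plateau state (`s + 1 ≤ q`, `q + 1 ≤ 2s`, `2 ∤ 3`, `|r| + 2s = 2q`).  The FREE
chart `z` with centre `e_v` (the point `(0:1:1) ∈ P(Π) ∩ P(W_u)`, off `W_v`) is a near move and yields, over ANY field,
`translate e_v (cT_4^z F) = y_u y_z (y_v + 1)(y_v + 2)^3`; in characteristic 2 this is `y^{e_u + e_z} · y_v^3 (y_v + 1)`: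
again δ-balanced (walls `u`, `z`), shade 3, and the lost wall `v` has become the UNIT `y_v + 1` inside the new companion.
So free-chart moves DO occur on balanced tame plateaux: (W7) is load-bearing, and §3/§4/§5 are the laws that carry it
(the frame rotates: new free variable `y_v`, new frame hypersurface `h'' = y_v`). -/

section Exhibit

omit [Fintype σ] in
/-- **FREE-CHART EXHIBIT (any field).** [new] -/
theorem freeChart_exhibit {u v z : σ} (huz : u ≠ z) (hvz : v ≠ z) (huv : u ≠ v) :
    PointBlowup.translate (Function.update (0 : σ → K) v 1) (chartTransform 4 z (X u * X v * (X z + X v) ^ 3)) =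
      X u * X z * (X v + 1) * (X v + 1 + 1) ^ 3 := by
  have hF : (X u * X v * (X z + X v) ^ 3 : MvPolynomial σ K).IsHomogeneous 5 := by
    have h := ((isHomogeneous_X K u).mul (isHomogeneous_X K v)).mul
      (((isHomogeneous_X K z).add (isHomogeneous_X K v)).pow 3)
    exact h
  have hord : ((5 : ℕ) : ℕ∞) ≤ ordZero (X u * X v * (X z + X v) ^ 3 : MvPolynomial σ K) :=
    le_ordZero_of_isHomogeneous hF
  rw [chartTransform_eq_X_pow_mul_chartTransform z (show 4 ≤ 5 by norm_num) hord,
    chartTransform_eq_dehom_of_isHomogeneous z hF]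
  unfold NearCut.dehom
  rw [NearCut.translate_eq_aeval]
  simp only [map_mul, map_pow, map_add, aeval_X, Function.update_self, Function.update_of_ne huz,
    Function.update_of_ne hvz, Function.update_of_ne huv, Function.update_of_ne hvz.symm, map_one, Pi.zero_apply,
    C_0, add_zero]
  ring

omit [Fintype σ] in
/-- **FREE-CHART EXHIBIT in characteristic 2**: the transform is `y_u y_z · y_v^3 (y_v + 1)` — exceptional monomial
`y^{e_u + e_z}` (δ-balanced again), companion `y_v^3 (y_v + 1)` of order `3 = s` carrying the unit `y_v + 1`. [new] -/
theorem freeChart_exhibit_char_two [CharP K 2] {u v z : σ} (huz : u ≠ z) (hvz : v ≠ z) (huv : u ≠ v) :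
    PointBlowup.translate (Function.update (0 : σ → K) v 1) (chartTransform 4 z (X u * X v * (X z + X v) ^ 3)) =
      (X u * X z) * (X v ^ 3 * (X v + 1)) := by
  rw [freeChart_exhibit huz hvz huv]
  have h2 : (2 : MvPolynomial σ K) = 0 := by
    have := CharP.cast_eq_zero (MvPolynomial σ K) 2
    simpa using this
  have h11 : (X v + 1 + 1 : MvPolynomial σ K) = X v := by rw [add_assoc, one_add_one_eq_two, h2, add_zero]
  rw [h11]
  ring

omit [Fintype σ] [DecidableEq σ] in
/-- The new companion `y_v^3 (y_v + 1)` of the exhibit has order exactly `3 = s` (the shade is kept) and its cofactor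
`y_v + 1` is a unit at the new point. [new] -/
theorem freeChart_exhibit_shade (v : σ) :
    ordZero (X v ^ 3 * (X v + 1) : MvPolynomial σ K) = 3 ∧ constantCoeff (X v + 1 : MvPolynomial σ K) ≠ 0 := by
  have hunit : constantCoeff (X v + 1 : MvPolynomial σ K) ≠ 0 := by
    rw [map_add, constantCoeff_X, map_one, zero_add]; exact one_ne_zero
  refine ⟨?_, hunit⟩
  rw [ordZero_mul, ordZero_X_pow, (ordZero_eq_zero_iff _).mpr hunit, add_zero]
  rfl

end Exhibit

/-! ## §13 Transversality laws (for the g36 law `α_free ≠ 0`): a move with AXIS directrix `c·y_k^s` (k = kept wall)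
produces a companion congruent to `c·y_k^s` modulo the exceptional variable `y_j`; hence the next directrix lies in
the wall span `⟨y_k, y_j⟩` with `coeff_{y_k} ≠ 0` — so the kept wall is kept again and `StaysOnNewest` fails forever.
Pure algebra over any `σ`; the walk instantiation is g36 §2. -/

section Transversal

end Transversal

end Summit.ResolutionOfSingularities.ResolutionOfSingularities.Theorems.WallFrames
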